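import Summits.NavierStokesRegularity.NavierStokesRegularity.Theorems.QuietScarPocketDoorTerminalTrace
import Summits.NavierStokesRegularity.NavierStokesRegularity.Theorems.QuietScarPocketDoorUniformRadius
import Summits.NavierStokesRegularity.NavierStokesRegularity.Theorems.QuietScarPocketDoorHolomorphicLimit
import Summits.NavierStokesRegularity.NavierStokesRegularity.Theorems.QuietScarPocketDoorTraceOfLocal

/-!
# QuietScarPocketDoorLegF — door S31 «QuietScarPocketDoor»: LEG F CLOSED BY NAME (ns-s29-p2 g3)

The terminal-slice analyticity leg of door S31 (texts `QuietScarPocketDoorDefs` p622283 = nsreg-p1 g25 Sketch31 v2.1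
363b5766493b6c28 SEALED), assembled from its landed pieces by the kernel-checked compositions of the Defs file:

* `terminalSliceVelocityAnalyticity_holds : TerminalSliceVelocityAnalyticity` — PF, from PF-a `terminalTraceC1_holds`
  (p624330, ns-s29-p2), PF-b `terminalUniformRadius_holds` (PF-b′ p623372 ns-s29-p2 + PF-b″ p624616 nsreg-C26-p1), PF-c
  `analyticOfBoundedHolomorphicLimit_holds` (p623565, ns-s29-p2) through `terminalSliceVelocityAnalyticity_of_split`;
* `terminalSliceAnalyticity_holds : TerminalSliceAnalyticity` — the curl-trace form (`terminalSliceAnalyticity_of_velocity`);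
* `terminalTraceAnalytic_holds : TerminalTraceAnalytic` — LEG F in the limit form consumed by the door composition
  `targetScarPocket_of`, through PFℓ `terminalTraceAnalyticOfLocal_holds` (p624817, ns-s29-p2).

With this file the door closes by `targetScarPocket_of scarPocketZoom_holds terminalTraceAnalytic_holds frameTransferS31_holds`
once the LEAD's K-piece PK1 `scarPocketZoom_holds` lands (PT `frameTransferS31_holds` p623288 ✓).

`TerminalSliceAnalyticity` was filed by nsreg-p1 as «the first statement of the line NOT found in print or tree» (G2 of door
S15 / ROUND-1 `ApexScarAnalytic` in its weakest useful form): a classical Navier–Stokes solution bounded with bounded pressure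
on `(a,0) × B(x_c,4r)` has a REAL-ANALYTIC terminal curl (indeed velocity) trace on `B(x_c,r)` — Bradshaw–Grujić–Kukavica's
local analyticity radius read with the life-span GUARD removed (floating slice), Seregin–Šverák interior regularity for the
trace, two-constants/Weierstrass for the limit.

WHAT THIS IS NOT: not door S31 (PK1 open), not 0056, not NS regularity (0056 OPEN; S31 is a criterion door inside a
hypothetical one-point Type-I blow-up).
-/

noncomputable section

set_option linter.dupNamespace false

namespace Summit.NavierStokesRegularity.NavierStokesRegularity.Theorems.QuietScarPocketDoor

/-- **PF · `TerminalSliceVelocityAnalyticity` holds** (PF-a + PF-b + PF-c through `terminalSliceVelocityAnalyticity_of_split`). -/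
theorem terminalSliceVelocityAnalyticity_holds : TerminalSliceVelocityAnalyticity :=
  terminalSliceVelocityAnalyticity_of_split terminalTraceC1_holds terminalUniformRadius_holds
    analyticOfBoundedHolomorphicLimit_holds

/-- **LEG F, local curl-trace form · `TerminalSliceAnalyticity` holds.** -/
theorem terminalSliceAnalyticity_holds : TerminalSliceAnalyticity :=
  terminalSliceAnalyticity_of_velocity terminalSliceVelocityAnalyticity_holds

/-- **LEG F, limit form · `TerminalTraceAnalytic` holds** (through PFℓ `terminalTraceAnalyticOfLocal_holds`). -/
theorem terminalTraceAnalytic_holds : TerminalTraceAnalytic :=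
  terminalTraceAnalyticOfLocal_holds terminalSliceAnalyticity_holds

end Summit.NavierStokesRegularity.NavierStokesRegularity.Theorems.QuietScarPocketDoor

end
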